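import Mathlib
import HarnessLib
import Literature.Combinatorics.HironakaPolyhedraGame.Spivakovsky1983

/-!
# Spivakovsky's invariant for Hironaka's polyhedra game, on GENERATORS (§I of the paper)

Source: M. Spivakovsky, *A solution to Hironaka's polyhedra game*, Arithmetic and Geometry II,
Progr. Math. **36** (1983) 419–432 [Spivakovsky1983], §I «Notations» (a)–(g) and the definition of
the derived set `Δ₁`, read on the held scan `book:artinnd-geometry` (chunks p0280–p0282).

This file is part 1/4 of the DISCHARGE of the named fact
`Literature.Combinatorics.HironakaPolyhedraGame.Spivakovsky1983_winningStrategy`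
(`Spivakovsky1983.lean`): positions are the finite rational generating sets `A : Finset (Fin n → ℚ)`
of that file, and every notion of §I is typed ON GENERATORS:

* `omega A` = `ω(Δ)` (coordinatewise minimum), `tilde A a` = `ã = a − ω`, `dTildeOn A Γ` = `d_Γ(Δ̃)`,
  `dTilde A` = `d(Δ̃)`, `suppMin A` = `S(Δ)`;
* for a coordinate set `S` with complement `I₁ = Sᶜ` enumerated by `enumCompl S : Fin #I₁ ↪ Fin n`,
  `proj S` = the projection `P_S(α, β) = α/(1 − |β|)`, `genSet A` = the generating set `Ã/d̃ ∪ A` of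
  `[Δ̃/d(Δ̃) ∪ Δ]`, and `derived S A` = the DERIVED POSITION `Δ₁ = P_S(M_S ∩ [Δ̃/d(Δ̃) ∪ Δ])` given by
  its generators `P_S(w)`, `w ∈ Ã/d̃ ∪ A`, `Σ_{j∈S} w_j < 1` (a perspective map sends the positive convex
  hull of the generators with `|β| < 1` onto `P_S` of the hull inside `M_S`); it is a position of
  dimension `#I₁`, re-indexed by `Fin #I₁` so that the game vocabulary of `Spivakovsky1983.lean`
  applies to it verbatim;
* `liftMove S Γ₁ = S ∪ Γ₁` is the move of §II induced upstairs by a move `Γ₁ ⊆ I₁` downstairs;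
* `IsLattice N A`: all coordinates lie in `(1/N)ℤ` (the «bounded denominators» of p. 432).

Design: no convex geometry is needed — every quantity of §I that the proof uses is the minimum over
`Δ` of a linear functional with non-negative coefficients, attained on a generator.  Every functional
minimum on an EMPTY set is given the junk value `0` (documented; positions are non-empty).
Parts 2–4: `Spivakovsky1983Derived.lean` (sums, membership, lattice bookkeeping, the move calculus),
`Spivakovsky1983Lemmas.lean` (Lemmas 1–3 of §III), `Spivakovsky1983Proof.lean` (the theorem).
Generator-level reading of §I concurred in by res-D-pv-038 (cell note 2026-08-27).
-/

namespace Literature.Combinatorics.HironakaPolyhedraGame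

namespace Spivakovsky1983

open Finset

variable {n : ℕ}

/-! ## §I Notations (a)–(g) on generators -/

/-- `ω(A)_j = min_{a ∈ A} a_j` (and `0` on the empty set). [cite: Spivakovsky1983, §I Notation (a)] -/
noncomputable def omega (A : Finset (Fin n → ℚ)) (j : Fin n) : ℚ :=
  if h : A.Nonempty then A.inf' h (fun a => a j) else 0

/-- `ã = a − ω(A)`. [cite: Spivakovsky1983, §I Notation (b), (d)] -/
noncomputable def tilde (A : Finset (Fin n → ℚ)) (a : Fin n → ℚ) : Fin n → ℚ :=
  fun j => a j - omega A j

/-- `d_Γ(Δ̃) = min_{a ∈ A} Σ_{j ∈ Γ} ã_j` (and `0` on the empty set). [cite: Spivakovsky1983, §I Notation (c)] -/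
noncomputable def dTildeOn (A : Finset (Fin n → ℚ)) (Γ : Finset (Fin n)) : ℚ :=
  if h : A.Nonempty then A.inf' h (fun a => ∑ j ∈ Γ, tilde A a j) else 0

/-- `d(Δ̃) = min_{a ∈ A} |ã|`. [cite: Spivakovsky1983, §I Notation (c) p. 421] -/
noncomputable def dTilde (A : Finset (Fin n → ℚ)) : ℚ := dTildeOn A univ

open Classical in
/-- `S(Δ)` = the coordinates `j` such that some `|·|`-minimal generator `a` has `ã_j ≠ 0`.
[cite: Spivakovsky1983, §I Notation (f)] -/
noncomputable def suppMin (A : Finset (Fin n → ℚ)) : Finset (Fin n) :=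
  univ.filter fun j => ∃ a ∈ A, (∑ k, tilde A a k) = dTilde A ∧ tilde A a j ≠ 0

/-- The enumeration of the complement `I₁ = Sᶜ` of a coordinate set `S` by `Fin (Sᶜ.card)` (the paper indexes `ℝ^{I₁}` by `I₁` itself). [cite: Spivakovsky1983, §I Notation (g) p. 421] -/
noncomputable def enumCompl (S : Finset (Fin n)) : Fin (Sᶜ.card) ↪ Fin n :=
  ⟨fun t => ((Sᶜ.orderIsoOfFin rfl) t : Fin n), fun t t' h => by
    have := Subtype.ext h
    exact (Sᶜ.orderIsoOfFin rfl).injective this⟩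

/-- The projection `P_S(w) = w_{I₁} / (1 − Σ_{j∈S} w_j)`, re-indexed by `Fin (Sᶜ.card)`.
[cite: Spivakovsky1983, §I Notation (g)] -/
noncomputable def proj (S : Finset (Fin n)) (w : Fin n → ℚ) : Fin (Sᶜ.card) → ℚ :=
  fun t => w (enumCompl S t) / (1 - ∑ j ∈ S, w j)

/-- The generating set `Ã/d̃ ∪ A` of `[Δ̃/d(Δ̃) ∪ Δ]`. [cite: Spivakovsky1983, §I definition of Δ₁, p. 421] -/
noncomputable def genSet (A : Finset (Fin n → ℚ)) : Finset (Fin n → ℚ) :=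
  A ∪ A.image (fun a j => tilde A a j / dTilde A)

open Classical in
/-- The derived position `Δ₁ = P_S(M_S ∩ [Δ̃/d(Δ̃) ∪ Δ])` ON GENERATORS, for a coordinate set `S`:
the images under `P_S` of the generators `w ∈ Ã/d̃ ∪ A` with `Σ_{j∈S} w_j < 1`.
[cite: Spivakovsky1983, §I, definition of Δ₁] -/
noncomputable def derived (S : Finset (Fin n)) (A : Finset (Fin n → ℚ)) :
    Finset (Fin (Sᶜ.card) → ℚ) :=
  ((genSet A).filter fun w => ∑ j ∈ S, w j < 1).image (proj S)

/-- The move upstairs induced by a move `Γ₁` of the derived game: `Γ = S ∪ Γ₁`.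
[cite: Spivakovsky1983, §II] -/
noncomputable def liftMove (S : Finset (Fin n)) (Γ₁ : Finset (Fin (Sᶜ.card))) : Finset (Fin n) :=
  S ∪ Γ₁.map (enumCompl S)

/-- All coordinates of all generators lie in `(1/N)ℤ` («N an upper bound on the denominators of the vertices' coordinates»). [cite: Spivakovsky1983, §III p. 432] -/
def IsLattice (N : ℕ) (A : Finset (Fin n → ℚ)) : Prop :=
  ∀ a ∈ A, ∀ j, ∃ z : ℤ, a j = z / N

/-! ## §2 — the lemmas (statements) -/

/-! ### positions, moves, lattices -/

/-! ## Elementary properties of `ω`, `ã`, `d_Γ(Δ̃)`, `d(Δ̃)`, `S(Δ)` -/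

/-- A move `σ_{Γ,i}` keeps all coordinates in `(1/N)ℤ`. [cite: Spivakovsky1983, §III p. 432 («N remains a bound after the transformation σ»)] -/
theorem isLattice_image_gameMove {N : ℕ} (hN : 0 < N) {A : Finset (Fin n → ℚ)}
    (hA : IsLattice N A) (Γ : Finset (Fin n)) (i : Fin n) :
    IsLattice N (A.image (gameMove Γ i)) := by
  intro b hb j
  obtain ⟨a, ha, rfl⟩ := Finset.mem_image.1 hb
  choose z hz using hA a ha
  simp only [gameMove]
  split_ifs with hj
  · refine ⟨∑ k ∈ Γ, z k - N, ?_⟩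
    have hN' : (N : ℚ) ≠ 0 := by exact_mod_cast hN.ne'
    rw [Finset.sum_congr rfl (fun k _ => hz k), ← Finset.sum_div]
    field_simp
    push_cast
    ring
  · exact ⟨z j, hz j⟩

/-- Every finite rational generating set has a common denominator `N`. [cite: Spivakovsky1983, §III p. 432] -/
theorem exists_isLattice (A : Finset (Fin n → ℚ)) : ∃ N : ℕ, 0 < N ∧ IsLattice N A := by
  refine ⟨∏ a ∈ A, ∏ j, (a j).den, ?_, ?_⟩
  · exact Finset.prod_pos (fun a _ => Finset.prod_pos (fun j _ => (a j).den_pos))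
  · intro a ha j
    have hdvd : (a j).den ∣ ∏ a ∈ A, ∏ j, (a j).den :=
      dvd_trans (Finset.dvd_prod_of_mem (fun j => (a j).den) (Finset.mem_univ j))
        (Finset.dvd_prod_of_mem (fun a => ∏ j, (a j).den) ha)
    obtain ⟨c, hc⟩ := hdvd
    refine ⟨(a j).num * c, ?_⟩
    rw [hc]
    have hd : ((a j).den : ℚ) ≠ 0 := by exact_mod_cast (a j).den_pos.ne'
    have hc0 : (c : ℚ) ≠ 0 := by
      have : c ≠ 0 := by
        rintro rfl
        have h0 : ∏ a ∈ A, ∏ j, (a j).den = 0 := by rw [hc]; simp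
        exact (Finset.prod_pos (fun a _ => Finset.prod_pos (fun j _ => (a j).den_pos))).ne' h0
      exact_mod_cast this
    push_cast
    rw [mul_div_mul_right _ _ hc0]
    exact (Rat.num_div_den (a j)).symm

/-! ### ω, ã, d̃ -/

/-- `ω(A)_j ≤ a_j` for every generator `a`. [cite: Spivakovsky1983, §I Notation (a) p. 420] -/
theorem omega_le {A : Finset (Fin n → ℚ)} {a : Fin n → ℚ} (ha : a ∈ A) (j : Fin n) :
    omega A j ≤ a j := by
  have hA : A.Nonempty := ⟨a, ha⟩
  simp only [omega, dif_pos hA]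
  exact Finset.inf'_le _ ha

/-- `ã_j ≥ 0`, i.e. `Δ̃ ⊂ ℝⁿ₊`. [cite: Spivakovsky1983, §I Notation (b), Note p. 421] -/
theorem tilde_nonneg {A : Finset (Fin n → ℚ)} {a : Fin n → ℚ} (ha : a ∈ A) (j : Fin n) :
    0 ≤ tilde A a j := by
  simp only [tilde, sub_nonneg]
  exact omega_le ha j

/-- The minimum `ω(A)_j` is attained on a generator. [cite: Spivakovsky1983, §I Notation (a) p. 420] -/
theorem exists_apply_eq_omega {A : Finset (Fin n → ℚ)} (hA : A.Nonempty) (j : Fin n) :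
    ∃ a ∈ A, a j = omega A j := by
  simp only [omega, dif_pos hA]
  obtain ⟨a, ha, h⟩ := Finset.exists_mem_eq_inf' hA (fun a => a j)
  exact ⟨a, ha, h.symm⟩

/-- `d_Γ(Δ̃) ≤ Σ_{j∈Γ} ã_j` for every generator. [cite: Spivakovsky1983, §I Notation (c) p. 421] -/
theorem dTildeOn_le {A : Finset (Fin n → ℚ)} {a : Fin n → ℚ} (ha : a ∈ A) (Γ : Finset (Fin n)) :
    dTildeOn A Γ ≤ ∑ j ∈ Γ, tilde A a j := by
  have hA : A.Nonempty := ⟨a, ha⟩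
  simp only [dTildeOn, dif_pos hA]
  exact Finset.inf'_le _ ha

/-- The minimum `d_Γ(Δ̃)` is attained on a generator. [cite: Spivakovsky1983, §I Notation (c) p. 421] -/
theorem exists_dTildeOn_eq {A : Finset (Fin n → ℚ)} (hA : A.Nonempty) (Γ : Finset (Fin n)) :
    ∃ a ∈ A, ∑ j ∈ Γ, tilde A a j = dTildeOn A Γ := by
  simp only [dTildeOn, dif_pos hA]
  obtain ⟨a, ha, h⟩ := Finset.exists_mem_eq_inf' hA (fun a => ∑ j ∈ Γ, tilde A a j)
  exact ⟨a, ha, h.symm⟩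

/-- `d_Γ(Δ̃) ≤ d(Δ̃)` («obvious from the definition»). [cite: Spivakovsky1983, §III proof of Lemma 1, p. 423] -/
theorem dTildeOn_le_dTilde {A : Finset (Fin n → ℚ)} (hA : A.Nonempty) (Γ : Finset (Fin n)) :
    dTildeOn A Γ ≤ dTilde A := by
  obtain ⟨a, ha, h⟩ := exists_dTildeOn_eq hA univ
  unfold dTilde
  rw [← h]
  refine (dTildeOn_le ha Γ).trans ?_
  exact Finset.sum_le_sum_of_subset_of_nonneg (Finset.subset_univ Γ)
    (fun j _ _ => tilde_nonneg ha j)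

/-- `d(Δ̃) ≥ 0`. [cite: Spivakovsky1983, §I Notation (c) p. 421] -/
theorem dTilde_nonneg (A : Finset (Fin n → ℚ)) : 0 ≤ dTilde A := by
  unfold dTilde dTildeOn
  split_ifs with hA
  · obtain ⟨a, ha, h⟩ := Finset.exists_mem_eq_inf' hA (fun a => ∑ j ∈ univ, tilde A a j)
    rw [h]
    exact Finset.sum_nonneg (fun j _ => tilde_nonneg ha j)
  · exact le_rfl

/-! ### the orthant case (Lemma 3) -/

/-- If `d(Δ̃) = 0` then `ω(A)` is a generator, i.e. `Δ = [ω]` is an orthant («Δ is generated by one point, ω(Δ)»). [cite: Spivakovsky1983, §III p. 431] -/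
theorem omega_mem_of_dTilde_eq_zero {A : Finset (Fin n → ℚ)} (hA : A.Nonempty)
    (h : dTilde A = 0) : (fun j => omega A j) ∈ A := by
  obtain ⟨a, ha, hsum⟩ := exists_dTildeOn_eq hA univ
  have h0 : ∑ j ∈ univ, tilde A a j = 0 := by rw [hsum]; exact h
  have hz := (Finset.sum_eq_zero_iff_of_nonneg (fun j _ => tilde_nonneg ha j)).1 h0
  have : (fun j => omega A j) = a := by
    funext j
    have := hz j (mem_univ j)
    simp only [tilde, sub_eq_zero] at this
    exact this.symm
  rw [this]
  exact ha

/-- Membership in `S(Δ)`. [cite: Spivakovsky1983, §I Notation (f) p. 421] -/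
theorem mem_suppMin {A : Finset (Fin n → ℚ)} {j : Fin n} :
    j ∈ suppMin A ↔ ∃ a ∈ A, (∑ k, tilde A a k) = dTilde A ∧ tilde A a j ≠ 0 := by
  classical
  simp [suppMin]

/-- `S(Δ) ≠ ∅` when `d(Δ̃) > 0`. [cite: Spivakovsky1983, §I Notation (f) p. 421] -/
theorem suppMin_nonempty {A : Finset (Fin n → ℚ)} (hA : IsPosition A) (hd : 0 < dTilde A) :
    (suppMin A).Nonempty := by
  obtain ⟨a, ha, hsum⟩ := exists_dTildeOn_eq hA.1 univ
  by_contra hne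
  rw [Finset.not_nonempty_iff_eq_empty] at hne
  have hz : ∀ j, tilde A a j = 0 := by
    intro j
    by_contra hj
    have : j ∈ suppMin A := mem_suppMin.2 ⟨a, ha, hsum, hj⟩
    rw [hne] at this
    simp at this
  have : dTilde A = 0 := by
    unfold dTilde
    rw [← hsum]
    exact Finset.sum_eq_zero (fun j _ => hz j)
  exact hd.ne' this

end Spivakovsky1983

end Literature.Combinatorics.HironakaPolyhedraGame
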